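import Mathlib
import Literature.AlgebraicGeometry.Resolution.LogChartMonomialLemmas
import Literature.AlgebraicGeometry.Resolution.DivisorialMonoidPrimes
import Literature.AlgebraicGeometry.Resolution.RegularParameterFamilies
import Literature.AlgebraicGeometry.Resolution.RegularLocalRingsNormal
import Summits.ResolutionOfSingularities.ResolutionOfSingularities.Theorems.PAlterationPicoverLocalModelNormalizationGlue
import Summits.ResolutionOfSingularities.ResolutionOfSingularities.Theorems.PAlterationPicoverLocalModelWoundTwistParameters

/-!
# Crux `PicoverLocalModel` (stmt-ResolutionOfSingularities-0557), line `SketchIdeator3`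
# (giraud-cossart-normal-form) — endgame, local charts: Kato's condition and the divisorial
# monoid at a wound / transversal point of the normalised cover

Helper of the stub `stub_localCharts`. Let `O` be a regular local ring of characteristic `p`
with boundary equations `x_1, …, x_r ∈ 𝔪` independent modulo `𝔪²`, and let the radicand be in
wound/transversal form `a = g^p + (∏ x_j^{B_j})^p u` at `O` (`IsWoundOrTransversalAt`). Let `N`
be an `O`-algebra which is an integrally closed domain, integral over `O`, with `O → N`
injective, containing a `p`-th root `t` of `a` and birational to `O[t]` — the shape in which the
local rings of the normalised `p`-cyclic cover present themselves. Then
(`isLogRegularLocal_of_woundForm`):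

* `N ≅ O[s]/(s^p - u)` is a regular local ring (`range_woundTwist_eq_integralClosure`,
  `exists_algEquiv_of_integralClosure_eq_range`, `isRegularLocalRing_woundTwist`);
* every chart `ψ : P → N` by an fs monoid `P ⊆ ℤⁿ` whose values are MONOMIAL up to `p`-th
  powers — `ψ(v)^p = η_v · ∏ x_j^{p m_j(v)}` with `η_v ∈ O^×` and `m : P → ℕʳ` additive hitting
  the unit vectors, with `rank {v | m v = 0} = n - r` — satisfies Kato's (2.1): Kato's ideal is
  `(x_1, …, x_r) N`, `N/(x) ≅ O[s]/(s^p - u)/(x)` is regular of dimension `dim N - r`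
  (`isRegularLocalRing_woundTwist_quotient_parameters`);
* the divisorial monoid of the boundary `∏ x_j` in `N` is generated by the units and `ψ(P)`
  (the `x_j` stay prime in the regular `N`, `divisorialMonoid_span_prod_eq_sup_closure`).
-/

noncomputable section

-- single-problem summit: the doubled namespace component `ResolutionOfSingularities` is the tree layout
set_option linter.dupNamespace false

open IsLocalRing Polynomial Literature.AlgebraicGeometry.Resolution

namespace Summit.ResolutionOfSingularities.ResolutionOfSingularities.Theorems.PicoverLocalModel.LocalCharts

/-- A product of powers is a unit iff every factor with a positive exponent is a unit; for
non-units `y_j` this means all exponents vanish. [folklore] -/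
theorem prod_pow_isUnit_iff_eq_zero {N : Type*} [CommMonoid N] {r : ℕ} {y : Fin r → N}
    (hy : ∀ j, ¬ IsUnit (y j)) (k : Fin r → ℕ) : IsUnit (∏ j, y j ^ k j) ↔ k = 0 := by
  constructor
  · intro h
    funext j
    by_contra hk
    have hj := (IsUnit.prod_univ_iff.mp h) j
    exact hy j ((isUnit_pow_iff hk).mp hj)
  · rintro rfl
    simp

/-- **Kato's condition and the divisorial monoid at a wound/transversal point.** See the module
docstring. [cite: Kato1994, Def. (2.1) and Thm. 11.6] -/
theorem isLogRegularLocal_of_woundForm : ∀ {O N : Type*} [CommRing O] [IsRegularLocalRing O] (p : ℕ) [Fact p.Prime] [CharP O p] [CommRing N] [IsDomain N] [IsIntegrallyClosed N] [Algebra O N] [Algebra.IsIntegral O N] {r : ℕ} (x : Fin r → O), (∀ j, x j ∈ IsLocalRing.maximalIdeal O) → (∀ α : Fin r → O, ∑ i, α i * x i ∈ IsLocalRing.maximalIdeal O ^ 2 → ∀ i, α i ∈ IsLocalRing.maximalIdeal O) → ∀ (a g u : O) (B : Fin r → ℕ), IsWoundOrTransversalAt p x u → a = g ^ p + (∏ j,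 x j ^ B j) ^ p * u → ∀ [IsDomain (AdjoinRoot ((Polynomial.X : Polynomial O) ^ p - Polynomial.C a))] (t : N), t ^ p = algebraMap O N a → Function.Injective (algebraMap O N) → (∀ z : N, ∃ d : O, d ≠ 0 ∧ ∃ q : Polynomial O, algebraMap O N d * z = Polynomial.aeval t q) → ∀ {n : ℕ} (P : AddSubmonoid (Fin n → ℤ)) (ψ : Multiplicative P →* N) (m : P →+ (Fin r → ℕ)), (∀ v : P, ∃ η : O, IsUnit η ∧ ψ (Multiplicative.ofAdd v) ^ p = algebraMap O N (η * ∏ j, x j ^ (p * m v j))) → (∀ j, ∃ v : P, m v = Pi.single j 1) → Module.finrank ℤ (Submodule.span ℤ ((fun v : P => (v : Fin n → ℤ)) '' {v | m v = 0})) + r = n → IsRegularLocalRing N ∧ LogChart.IsLogRegularLocal P ψ ∧ divisorialMonoid (Ideal.span {algebraMap O N (∏ j, x j)}) = IsUnit.submonoid N ⊔ MonoidHom.mrange ψ := by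
  intro O N _ _ p _ _ _ _ _ _ _ r x hx hli a g u B hu ha _ t ht hinj hbir n P ψ m hψ hm hrank
  classical
  have hp : p.Prime := Fact.out
  haveI := isDomain_of_isRegularLocalRing O
  have hx0 : ∀ j, x j ≠ 0 := fun j h0 =>
    RegularParameters.notMem_sq hli j (h0 ▸ Ideal.zero_mem _)
  -- the wound twist model `C' = O[s]/(s^p - u)`
  haveI hregC : IsRegularLocalRing (AdjoinRoot ((X : O[X]) ^ p - C u)) :=
    isRegularLocalRing_woundTwist p x u hu
  haveI : IsDomain (AdjoinRoot ((X : O[X]) ^ p - C u)) := isDomain_of_isRegularLocalRing _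
  haveI : IsIntegrallyClosed (AdjoinRoot ((X : O[X]) ^ p - C u)) :=
    isIntegrallyClosed_of_isRegularLocalRing _
  haveI : Module.Finite O (AdjoinRoot ((X : O[X]) ^ p - C u)) :=
    (monic_X_pow_sub_C u hp.ne_zero).finite_adjoinRoot
  haveI : Algebra.IsIntegral O (AdjoinRoot ((X : O[X]) ^ p - C u)) := inferInstance
  have hxB : (∏ j, x j ^ B j) ≠ 0 :=
    Finset.prod_ne_zero_iff.mpr fun j _ => pow_ne_zero _ (hx0 j)
  obtain ⟨φ, hφinj, -, hrange⟩ :=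
    WoundTwistIntegralClosure.range_woundTwist_eq_integralClosure p a g u (∏ j, x j ^ B j) hxB ha
  -- glue: `N ≅ C'` over `O`
  have hmonic : ((X : O[X]) ^ p - C a).Monic := monic_X_pow_sub_C a hp.ne_zero
  have ht' : aeval t ((X : O[X]) ^ p - C a) = 0 := by
    rw [map_sub, map_pow, aeval_X, aeval_C, ht, sub_self]
  obtain ⟨e⟩ := exists_algEquiv_of_integralClosure_eq_range _ hmonic t ht' hinj hbir φ hφinj hrange
  haveI hregN : IsRegularLocalRing N := IsRegularLocalRing.of_ringEquiv e.symm.toRingEquiv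
  -- units coming from `O`
  have hunit : ∀ y : O, IsUnit (algebraMap O N y) ↔ IsUnit y := fun y => by
    rw [← isUnit_algebraMap_iff_of_isIntegral (C := AdjoinRoot ((X : O[X]) ^ p - C u)) y,
      ← e.commutes y]
    exact (isUnit_map_iff e _).symm
  have hxN : ∀ j, ¬ IsUnit (algebraMap O N (x j)) := fun j h =>
    (IsLocalRing.mem_maximalIdeal _).mp (hx j) ((hunit _).mp h)
  have hx0N : ∀ j, algebraMap O N (x j) ≠ 0 := fun j => (map_ne_zero_iff _ hinj).mpr (hx0 j)
  -- the quotient by the boundary equations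
  set I : Ideal N := Ideal.span (Set.range fun j => algebraMap O N (x j)) with hIdef
  have hIJ : (Ideal.span (Set.range x)).map (AdjoinRoot.of ((X : O[X]) ^ p - C u)) =
      I.map (e.toRingEquiv : N →+* AdjoinRoot ((X : O[X]) ^ p - C u)) := by
    have hfun : (AdjoinRoot.of ((X : O[X]) ^ p - C u)) ∘ x =
        (e.toRingEquiv : N →+* AdjoinRoot ((X : O[X]) ^ p - C u)) ∘
          (fun j => algebraMap O N (x j)) := by
      funext j
      simp only [Function.comp_apply]
      change AdjoinRoot.of _ (x j) = e (algebraMap O N (x j))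
      rw [e.commutes]
      rfl
    rw [hIdef, Ideal.map_span, Ideal.map_span, ← Set.range_comp, ← Set.range_comp, hfun]
  obtain ⟨hregQ, hdimQ⟩ :=
    isRegularLocalRing_woundTwist_quotient_parameters p x hx hli u hu
  let eQ := Ideal.quotientEquiv I _ (e.toRingEquiv : N ≃+* AdjoinRoot ((X : O[X]) ^ p - C u)) hIJ
  haveI hregNI : IsRegularLocalRing (N ⧸ I) :=
    @IsRegularLocalRing.of_ringEquiv _ _ hregQ _ _ eQ.symm
  have hdimNI : ringKrullDim (N ⧸ I) + r = ringKrullDim N := by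
    rw [ringKrullDim_eq_of_ringEquiv eQ, ringKrullDim_eq_of_ringEquiv e.toRingEquiv, hdimQ]
  -- monomial structure of the chart values
  have key : ∀ v : P, ∃ γ : N, IsUnit γ ∧
      ψ (Multiplicative.ofAdd v) = γ * ∏ j, algebraMap O N (x j) ^ m v j := by
    intro v
    obtain ⟨η, hη, hv⟩ := hψ v
    refine exists_isUnit_mul_of_pow_eq_unit_mul_pow hp.ne_zero ((hunit η).mpr hη)
      (Finset.prod_ne_zero_iff.mpr fun j _ => pow_ne_zero _ (hx0N j)) ?_
    rw [hv, map_mul, map_prod, ← Finset.prod_pow]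
    congr 1
    exact Finset.prod_congr rfl fun j _ => by rw [map_pow, ← pow_mul, mul_comm]
  have hunitψ : ∀ v : P, IsUnit (ψ (Multiplicative.ofAdd v)) ↔ m v = 0 := by
    intro v
    obtain ⟨γ, hγ, hv⟩ := key v
    rw [hv, IsUnit.mul_iff, and_iff_right hγ]
    exact prod_pow_isUnit_iff_eq_zero hxN (m v)
  -- Kato's ideal is `(x) N`
  have hnon : LogChart.nonunitIdeal P ψ = I := by
    apply le_antisymm
    · refine Ideal.span_le.mpr ?_
      rintro _ ⟨v, hv, rfl⟩
      have hm0 : m v ≠ 0 := fun h0 => hv ((hunitψ v).mpr h0)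
      obtain ⟨j, hj⟩ : ∃ j, m v j ≠ 0 := by
        by_contra hall; push Not at hall; exact hm0 (funext hall)
      obtain ⟨γ, -, hγv⟩ := key v
      change ψ (Multiplicative.ofAdd v) ∈ I
      rw [hγv, ← Finset.mul_prod_erase _ _ (Finset.mem_univ j)]
      have hxI : algebraMap O N (x j) ∈ I := Ideal.subset_span ⟨j, rfl⟩
      exact Ideal.mul_mem_left _ _ (Ideal.mul_mem_right _ _ (Ideal.pow_mem_of_mem I hxI _
        (Nat.pos_of_ne_zero hj)))
    · refine Ideal.span_le.mpr ?_
      rintro _ ⟨j, rfl⟩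
      obtain ⟨v, hv⟩ := hm j
      obtain ⟨γ, hγ, hγv⟩ := key v
      rw [hv] at hγv
      have hprod : ∏ i, algebraMap O N (x i) ^ (Pi.single j 1 : Fin r → ℕ) i =
          algebraMap O N (x j) := by
        rw [Finset.prod_eq_single j (fun i _ hij => by rw [Pi.single_eq_of_ne hij, pow_zero])
          (fun h => absurd (Finset.mem_univ j) h), Pi.single_eq_same, pow_one]
      rw [hprod] at hγv
      have hmem : ψ (Multiplicative.ofAdd v) ∈ LogChart.nonunitIdeal P ψ := by
        refine Ideal.subset_span ⟨v, ?_, rfl⟩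
        change ¬ IsUnit (ψ (Multiplicative.ofAdd v))
        rw [hunitψ, hv]
        intro h
        have h1 : (Pi.single j 1 : Fin r → ℕ) j = 0 := by rw [h]; rfl
        rw [Pi.single_eq_same] at h1
        exact one_ne_zero h1
      have : algebraMap O N (x j) = ↑hγ.unit⁻¹ * ψ (Multiplicative.ofAdd v) := by
        rw [hγv, ← mul_assoc, IsUnit.val_inv_mul, one_mul]
      change algebraMap O N (x j) ∈ _
      rw [this]
      exact Ideal.mul_mem_left _ _ hmem
  have hface : LogChart.unitFace P ψ = {v | m v = 0} := Set.ext fun v => hunitψ v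
  have hlog : LogChart.IsLogRegularLocal P ψ :=
    LogChart.isLogRegularLocal_of_eq P ψ I hnon hregNI r hdimNI (by rw [hface]; exact hrank)
  refine ⟨hregN, hlog, ?_⟩
  -- the divisorial monoid
  have hxmax : ∀ j, algebraMap O N (x j) ∈ maximalIdeal N := fun j =>
    (IsLocalRing.mem_maximalIdeal _).mpr (hxN j)
  have hprime : ∀ j, Prime (algebraMap O N (x j)) :=
    prime_of_isRegularLocalRing_quotient (fun j => algebraMap O N (x j)) hxmax hregNI hdimNI
  rw [map_prod, divisorialMonoid_span_prod_eq_sup_closure _ fun j => Or.inl (hprime j)]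
  apply le_antisymm
  · refine sup_le le_sup_left (Submonoid.closure_le.mpr ?_)
    rintro _ ⟨j, rfl⟩
    obtain ⟨v, hv⟩ := hm j
    obtain ⟨γ, hγ, hγv⟩ := key v
    rw [hv] at hγv
    have hprod : ∏ i, algebraMap O N (x i) ^ (Pi.single j 1 : Fin r → ℕ) i =
        algebraMap O N (x j) := by
      rw [Finset.prod_eq_single j (fun i _ hij => by rw [Pi.single_eq_of_ne hij, pow_zero])
        (fun h => absurd (Finset.mem_univ j) h), Pi.single_eq_same, pow_one]
    rw [hprod] at hγv
    refine Submonoid.mem_sup.mpr ⟨(↑hγ.unit⁻¹ : N), (IsUnit.mem_submonoid_iff _).mpr (Units.isUnit _),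
      ψ (Multiplicative.ofAdd v), ⟨Multiplicative.ofAdd v, rfl⟩, ?_⟩
    rw [hγv, ← mul_assoc, IsUnit.val_inv_mul, one_mul]
  · refine sup_le le_sup_left ?_
    rintro _ ⟨v, rfl⟩
    obtain ⟨γ, hγ, hγv⟩ := key (Multiplicative.toAdd v)
    rw [ofAdd_toAdd] at hγv
    refine Submonoid.mem_sup.mpr ⟨γ, (IsUnit.mem_submonoid_iff _).mpr hγ,
      ∏ j, algebraMap O N (x j) ^ m (Multiplicative.toAdd v) j, ?_, hγv.symm⟩
    refine Submonoid.prod_mem _ fun j _ => Submonoid.pow_mem _ ?_ _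
    exact Submonoid.subset_closure (Set.mem_range_self j)

end Summit.ResolutionOfSingularities.ResolutionOfSingularities.Theorems.PicoverLocalModel.LocalCharts

end
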